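import Summits.QuantumFields.YangMills.Theorems.FluctuationComparisonRegPrIntLS2BetaBodyRebaseLift
import HarnessLib

/-!
# S2β · GAP♯∘ — (α)-DOORS «THE (RES-u) DOOR BY ONE NAME»: BODY at `((u↓)⁻¹•V, û•(r•U₀), u⁻¹•U)` ⟺ BODY at `(V, U₀, U)` for Thm 2's fine `u`, ANY lift `û` of `(u↓)⁻¹`
# (block-constant or px21's Lipschitz lift ✓p840262) and ANY residual copy `r•U₀` of the minimiser (w5's smooth residual copy ✓p840422) — plus the new triple's admissibility

Cell `ym3-torus` (rung R3 = continuum `SU(2)` YM₃ on T³ at fixed lattice data — NOT d = 4, NOT infinite volume, NOT a mass gap, NOT Clay).  Width seat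
`ym3-torus-px16` (gen 24); crux `stmt-QuantumFields-20520`, LINE g18-1 S2β (registry untouched); organ GAP♯∘; (RES-u) of record (architect px17 g23, desk №704); w5 g29
OFFER (α) 2026-09-01T03:03Z «the (RES-u) knit by one name», door half → px16.  The doors on the tree: ✓p839557 REBASE-U, ✓p840017 REBASE-U₀ + lift-independent triple,
✓p839899 composed door.  THIS FILE: ★★`body_iff_body_smoothMoved (hε₀) (u) (û) (hû : û↓ = (u↓)⁻¹) (hr : r residual)` — the residual carrying `u⁻¹•U` back to `û•(…)` is
`r″ := û⁻¹·u⁻¹` (`r″↓ = (u↓)·(u↓)⁻¹ = 1`, lit ✓`descTransf_mul`∕`descTransf_inv`, ✓`residual_of_descTransf_eq_one`), so BODY(`t•V, û•(r•U₀), û•(r″•U)`) ↔ BODY(`V, r•U₀, r″•U`)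
(✓`body_triple_iff_of_descTransf_eq`) ↔ BODY(`V, U₀, r″•U`) (✓`body_gaugeAct_residual_bkg_iff`) ↔ BODY(`V, U₀, U`) (✓`body_gaugeAct_residual_iff`); admissibility:
`smoothMoved_mem_argmin` (`û•(r•U₀) ∈ argmin-set((u↓)⁻¹•V)`); `u⁻¹•U ∈ fibre((u↓)⁻¹•V)` is ✓`thm2Moved_mem_fibre`; `histGood`∕datum guard by the tree's iff's.  The SIZES of the
new pair (`hrep : u⁻¹•U = E·(r•U₀)`, `E′`, windows) are w5's half, NOT here.
`--kind proof --supports stmt-QuantumFields-20520 --as helper`, count-neutral, DEFINITION-FREE (0 `def`, 0 `instance`, 0 `sorry`; default heartbeats).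

HONEST.  Composition of landed doors + one descent identity; sizes∕(REG)∕(REG-UP)∕(L2-TOWER)∕the B7 dictionary∕hsupp∕hD∕hDBX OPEN ∕ HYPOTHESES elsewhere; nothing of
Bałaban's analysis asserted ([Balaban1985Variational] p.278, Thm 1 (8)–(10) p.279; [Balaban1985Averaging] (8), (11)–(13) pp.18–19); GAP♯∘ (`stub_uniformFibreGapOrbit`, 0∕5), the
five REGISTERED stubs, S2β, crux 20520, 19936, 19200, `YM3TorusSU2` NOT proved; rung R3 = SU(2) YM₃ on T³ — NOT d = 4, NOT infinite volume, NOT a mass gap, NOT Clay; the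
Yang–Mills mass gap is NOT proved.
-/

set_option autoImplicit false

noncomputable section

namespace Summit.QuantumFields.YangMills.Theorems.FluctuationComparisonRegPrIntLS2BetaBodyDoorSmoothMoved

open Finset
open Literature.MathematicalPhysics.QuantumFieldTheory.Balaban1983to89
open T4Continuum T3ContinuumYM3Torus T3UnitScaleTilt T3TiltDescent T3LevelShift
open T3UnitLawDensityEML (ℰp)
open T3ConstrainedMinimiser (fibre)
open T3PrintedRegularMinimiser (minActionRegPr)
open T3PrintedRegularOrbits (liftTransfTo descTransf descendTo_gaugeAct)
open T3SectALandauChart (descTransf_inv descTransf_mul)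
open Summit.QuantumFields.YangMills.Theorems.FluctuationComparisonRegPrIntLS2BetaResidualGauge
  (gaugeAct_mul_eq residual_of_descTransf_eq_one gaugeAct_mem_argmin_iff_of_residual)
open Summit.QuantumFields.YangMills.Theorems.FluctuationComparisonRegPrIntLS2BetaBodyRebaseResidual (body_gaugeAct_residual_iff)
open Summit.QuantumFields.YangMills.Theorems.FluctuationComparisonRegPrIntLS2BetaBodyRebaseLift
  (body_gaugeAct_residual_bkg_iff body_triple_iff_of_descTransf_eq gaugeAct_lift_mem_argmin)

variable (F : T3Family) {J K : ℕ} (hJK : J ≤ K)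

/-! ## §1 The residual that carries `u⁻¹•U` onto the lift -/

/-- `r″ := û⁻¹·u⁻¹` is RESIDUAL when `û↓ = (u↓)⁻¹` (`r″↓ = 1`). [cite: Balaban1985Averaging, (11)-(13) p.19] -/
theorem residual_liftInv_mul_inv (u û : Site (F.P K) 0 → Matrix.specialUnitaryGroup (Fin 2) ℂ)
    (hû : descTransf F J K hJK û = fun x => (descTransf F J K hJK u x)⁻¹) :
    ∀ U : GaugeField (F.P K) 0 (Matrix.specialUnitaryGroup (Fin 2) ℂ),
      descendTo F ℰp J K hJK (GaugeField.gaugeAct (fun x => (û x)⁻¹ * (u x)⁻¹) U) = descendTo F ℰp J K hJK U := by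
  refine residual_of_descTransf_eq_one F hJK ?_
  rw [descTransf_mul, descTransf_inv, descTransf_inv, hû]
  funext x
  simp only [inv_inv, mul_inv_cancel]

/-- `u⁻¹•U = û•(r″•U)`. [cite: Balaban1985Averaging, (8) p.19] -/
theorem gaugeAct_inv_eq_lift_residual (u û : Site (F.P K) 0 → Matrix.specialUnitaryGroup (Fin 2) ℂ) (U : GaugeField (F.P K) 0 (Matrix.specialUnitaryGroup (Fin 2) ℂ)) :
    GaugeField.gaugeAct (fun x => (u x)⁻¹) U = GaugeField.gaugeAct û (GaugeField.gaugeAct (fun x => (û x)⁻¹ * (u x)⁻¹) U) := by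
  rw [← gaugeAct_mul_eq]
  congr 1
  funext x
  rw [Pi.mul_apply, mul_inv_cancel_left]

/-! ## §2 The door by one name -/

/-- ★★ **THE (RES-u) DOOR BY ONE NAME**: for `ε₀ ≥ 0`, a fine `u`, ANY `û` over `(u↓)⁻¹` and ANY residual `r`, the GAP♯∘ body (✓p838507's conclusion tail VERBATIM) at
`((u↓)⁻¹•V, û•(r•U₀), u⁻¹•U)` ⟺ at `(V, U₀, U)`. [cite: Balaban1985Variational, p.278, Thm 1 (8)-(10) p.279; Balaban1985RegularSpaces, Thm 2 p.83] -/
theorem body_iff_body_smoothMoved {ε₀ : ℝ} (hε₀ : 0 ≤ ε₀) (u û : Site (F.P K) 0 → Matrix.specialUnitaryGroup (Fin 2) ℂ)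
    (hû : descTransf F J K hJK û = fun x => (descTransf F J K hJK u x)⁻¹)
    {r : Site (F.P K) 0 → Matrix.specialUnitaryGroup (Fin 2) ℂ}
    (hr : ∀ U : GaugeField (F.P K) 0 (Matrix.specialUnitaryGroup (Fin 2) ℂ), descendTo F ℰp J K hJK (GaugeField.gaugeAct r U) = descendTo F ℰp J K hJK U)
    (μ : ℝ) (V : GaugeField (F.P J) 0 (Matrix.specialUnitaryGroup (Fin 2) ℂ)) (U₀ U : GaugeField (F.P K) 0 (Matrix.specialUnitaryGroup (Fin 2) ℂ)) :
    (μ * ((F.L : ℝ)⁻¹) ^ (2 * (K - J)) *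
          (⨅ w : {w : GaugeTransf (F.P K) 0 (Matrix.specialUnitaryGroup (Fin 2) ℂ) | ∀ U : GaugeField (F.P K) 0 (Matrix.specialUnitaryGroup (Fin 2) ℂ),
              descendTo F ℰp J K hJK (GaugeField.gaugeAct w U) = descendTo F ℰp J K hJK U}, ∑ ℓ : PBond (F.P K) 0,
            dist1 ((GaugeField.gaugeAct (fun x => (u x)⁻¹) U) ℓ *
              ((GaugeField.gaugeAct (w : GaugeTransf (F.P K) 0 (Matrix.specialUnitaryGroup (Fin 2) ℂ)) (GaugeField.gaugeAct û (GaugeField.gaugeAct r U₀))) ℓ)⁻¹) ^ 2)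
        ≤ wilsonAction4 (GaugeField.gaugeAct (fun x => (u x)⁻¹) U) - minActionRegPr F J K hJK ε₀ (GaugeField.gaugeAct (fun x => (descTransf F J K hJK u x)⁻¹) V)) ↔
      (μ * ((F.L : ℝ)⁻¹) ^ (2 * (K - J)) *
          (⨅ w : {w : GaugeTransf (F.P K) 0 (Matrix.specialUnitaryGroup (Fin 2) ℂ) | ∀ U : GaugeField (F.P K) 0 (Matrix.specialUnitaryGroup (Fin 2) ℂ),
              descendTo F ℰp J K hJK (GaugeField.gaugeAct w U) = descendTo F ℰp J K hJK U}, ∑ ℓ : PBond (F.P K) 0,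
            dist1 ((U) ℓ *
              ((GaugeField.gaugeAct (w : GaugeTransf (F.P K) 0 (Matrix.specialUnitaryGroup (Fin 2) ℂ)) (U₀)) ℓ)⁻¹) ^ 2)
        ≤ wilsonAction4 (U) - minActionRegPr F J K hJK ε₀ (V)) := by
  have hr'' := residual_liftInv_mul_inv F hJK u û hû
  rw [gaugeAct_inv_eq_lift_residual F u û U, body_triple_iff_of_descTransf_eq F hJK hε₀ û hû μ V,
    body_gaugeAct_residual_bkg_iff F hJK hr, body_gaugeAct_residual_iff F hJK hr'']

/-- USE FORM. [cite: Balaban1985Variational, Thm 1 (8)-(10) p.279] -/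
theorem body_of_body_smoothMoved {ε₀ : ℝ} (hε₀ : 0 ≤ ε₀) (u û : Site (F.P K) 0 → Matrix.specialUnitaryGroup (Fin 2) ℂ)
    (hû : descTransf F J K hJK û = fun x => (descTransf F J K hJK u x)⁻¹)
    {r : Site (F.P K) 0 → Matrix.specialUnitaryGroup (Fin 2) ℂ}
    (hr : ∀ U : GaugeField (F.P K) 0 (Matrix.specialUnitaryGroup (Fin 2) ℂ), descendTo F ℰp J K hJK (GaugeField.gaugeAct r U) = descendTo F ℰp J K hJK U)
    {μ : ℝ} {V : GaugeField (F.P J) 0 (Matrix.specialUnitaryGroup (Fin 2) ℂ)} {U₀ U : GaugeField (F.P K) 0 (Matrix.specialUnitaryGroup (Fin 2) ℂ)}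
    (h : (μ * ((F.L : ℝ)⁻¹) ^ (2 * (K - J)) *
          (⨅ w : {w : GaugeTransf (F.P K) 0 (Matrix.specialUnitaryGroup (Fin 2) ℂ) | ∀ U : GaugeField (F.P K) 0 (Matrix.specialUnitaryGroup (Fin 2) ℂ),
              descendTo F ℰp J K hJK (GaugeField.gaugeAct w U) = descendTo F ℰp J K hJK U}, ∑ ℓ : PBond (F.P K) 0,
            dist1 ((GaugeField.gaugeAct (fun x => (u x)⁻¹) U) ℓ *
              ((GaugeField.gaugeAct (w : GaugeTransf (F.P K) 0 (Matrix.specialUnitaryGroup (Fin 2) ℂ)) (GaugeField.gaugeAct û (GaugeField.gaugeAct r U₀))) ℓ)⁻¹) ^ 2)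
        ≤ wilsonAction4 (GaugeField.gaugeAct (fun x => (u x)⁻¹) U) - minActionRegPr F J K hJK ε₀ (GaugeField.gaugeAct (fun x => (descTransf F J K hJK u x)⁻¹) V))) :
    (μ * ((F.L : ℝ)⁻¹) ^ (2 * (K - J)) *
          (⨅ w : {w : GaugeTransf (F.P K) 0 (Matrix.specialUnitaryGroup (Fin 2) ℂ) | ∀ U : GaugeField (F.P K) 0 (Matrix.specialUnitaryGroup (Fin 2) ℂ),
              descendTo F ℰp J K hJK (GaugeField.gaugeAct w U) = descendTo F ℰp J K hJK U}, ∑ ℓ : PBond (F.P K) 0,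
            dist1 ((U) ℓ *
              ((GaugeField.gaugeAct (w : GaugeTransf (F.P K) 0 (Matrix.specialUnitaryGroup (Fin 2) ℂ)) (U₀)) ℓ)⁻¹) ^ 2)
        ≤ wilsonAction4 (U) - minActionRegPr F J K hJK ε₀ (V)) :=
  (body_iff_body_smoothMoved F hJK hε₀ u û hû hr μ V U₀ U).mp h

/-! ## §3 Admissibility of the new triple -/

/-- `û•(r•U₀) ∈ argmin-set((u↓)⁻¹•V)` (GAP♯∘'s set text) for `U₀ ∈ argmin-set(V)`, residual `r`, `û↓ = (u↓)⁻¹`. [cite: Balaban1985Variational, Thm 1 p.279, (3)-(4) p.278] -/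
theorem smoothMoved_mem_argmin {γ b₀ p₀ ε₀ : ℝ} (hε₀ : 0 ≤ ε₀) (u û : Site (F.P K) 0 → Matrix.specialUnitaryGroup (Fin 2) ℂ)
    (hû : descTransf F J K hJK û = fun x => (descTransf F J K hJK u x)⁻¹)
    {r : Site (F.P K) 0 → Matrix.specialUnitaryGroup (Fin 2) ℂ}
    (hr : ∀ U : GaugeField (F.P K) 0 (Matrix.specialUnitaryGroup (Fin 2) ℂ), descendTo F ℰp J K hJK (GaugeField.gaugeAct r U) = descendTo F ℰp J K hJK U)
    (V : GaugeField (F.P J) 0 (Matrix.specialUnitaryGroup (Fin 2) ℂ)) {U₀ : GaugeField (F.P K) 0 (Matrix.specialUnitaryGroup (Fin 2) ℂ)}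
    (hU₀ : U₀ ∈ {U' : GaugeField (F.P K) 0 (Matrix.specialUnitaryGroup (Fin 2) ℂ) | U' ∈ fibre F ℰp J K hJK V ∧ U' ∈ histGood F ℰp (θBal F.L γ b₀ p₀) K J ∧
      wilsonAction4 U' = minActionRegPr F J K hJK ε₀ V}) :
    GaugeField.gaugeAct û (GaugeField.gaugeAct r U₀) ∈ {U' : GaugeField (F.P K) 0 (Matrix.specialUnitaryGroup (Fin 2) ℂ) |
      U' ∈ fibre F ℰp J K hJK (GaugeField.gaugeAct (fun x => (descTransf F J K hJK u x)⁻¹) V) ∧ U' ∈ histGood F ℰp (θBal F.L γ b₀ p₀) K J ∧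
      wilsonAction4 U' = minActionRegPr F J K hJK ε₀ (GaugeField.gaugeAct (fun x => (descTransf F J K hJK u x)⁻¹) V)} :=
  gaugeAct_lift_mem_argmin F hJK hε₀ û hû V ((gaugeAct_mem_argmin_iff_of_residual F hJK hr U₀ V).mpr hU₀)

-- `u⁻¹•U ∈ fibre((u↓)⁻¹•V)` for `U ∈ fibre(V)`: ✓`…BodyDoorThm2Moved.thm2Moved_mem_fibre` (by name, not restated).

end Summit.QuantumFields.YangMills.Theorems.FluctuationComparisonRegPrIntLS2BetaBodyDoorSmoothMoved

end
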